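import Summits.Ventures.GridStability.Bench.NE39SPLoadStepA
import Summits.Ventures.GridStability.Bench.NE39SPLoadStepB
import Summits.Ventures.GridStability.Bench.NE39SPLoadStepC
import Summits.Ventures.GridStability.Bench.NE39SPLoadStepD
import Summits.Ventures.GridStability.Bench.NE39SPLoadStepE
import Summits.Ventures.GridStability.Bench.NE39SPLoadStepF
import Summits.Ventures.GridStability.Bench.NE39SPLoadStepG
import Summits.Ventures.GridStability.Bench.NE39SPLoadStepH
import Summits.Ventures.GridStability.Bench.NE39SPGenLossA
import Summits.Ventures.GridStability.Bench.NE39SPGenLossB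
import Summits.Ventures.GridStability.Bench.NE39SPLineSwitchAll
import HarnessLib

/-!
# GridStability/Bench/NE39SPStepAll — uniform injection-step sentences on the 49-node STRUCTURE-PRESERVING New
# England instance (column LF): «+5 pu sudden load pickup at ANY of the 39 network buses» (39/39) and «full loss of
# the mechanical input of ANY machine other than the equivalent» (9/9), each supplied at the same instant by the
# external-equivalent machine G2 — with the transient machine-speed bound (line «G2.b-NE39SP-LOADSTEP»)

Cell `gridfusion` (LADDER-GRIDFUSION), seat gridfusion-lyap-1 (g9). INSTANCE OF RECORD BY NAME: model-2's
`Models/NE39SP.lean` (data model-4 sp49.json fddec35dcf838149 = [cite: Padiyar2013, App. D]); per-bus / per-machine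
certificates `stepcertNN`/`stepcheckNN`/`stepNN_resync` (`Bench/NE39SPLoadStepA…H.lean`) and
`genlosscertNN`/`genlosscheckNN`/`genlossNN_resync` (`Bench/NE39SPGenLossA/B.lean`); `P0Q`, `Pstep`, `paramsStep`,
`step_resync_NE39SP` (`Bench/NE39SPStepDefs.lean`); the generic speed lemma `speed_le_of_energy_le`
(`Bench/NE39SPLineSwitchAll.lean`). NO NEW CERTIFICATE DATA (two index sets only).

THREE COLUMNS. CERTIFIED (kernel): `Pstep_at_self` / `Pstep_at_supplier` / `Pstep_elsewhere` (what the step IS,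
relative to the injections of record `P0Q = (NE39SP.params D).P0` by `P0Q_cast`); `exists_stepcert` (39/39 buses carry
a certificate with `R = 10⁻⁶`, `τγ = 21/100`, `c ≤ 141 / 100`); **`loadstep5_resync`** (uniform sentence: for EVERY network
bus and EVERY `D > 0`, the +5 pu power-transfer step re-synchronises from the pre-step synchronous state with
`V ≤ 141 / 100` throughout); `exists_genlosscert` (9/9 machines, `c ≤ 141 / 25`); **`genloss_resync`** (for EVERY machine
other than G2: the full-loss step — its injection EXACTLY `0` afterwards — re-synchronises); **`step_machine_speed_bound`**
(along all these transients `|δ̇ᵢ(t)| ≤ √(2c/Mᵢ)` for all `t ≥ 0`). MODELLED: model-2's tokens + «instantaneous BALANCED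
power-transfer step supplied by G2 (no governor / AGC dynamics), turbine trip without generator disconnection for the
loss steps, magnitudes frozen; 5 pu is a declared stress datum». VALIDATED: nothing in print. No sentence of this file
says the New England system is stable. Two small `Finset` definitions; no named fact; standard axioms.
-/

noncomputable section

open Set Filter Topology Real Finset
open Summit.Ventures.GridStability.Models
open Summit.Ventures.GridStability.Models.StructurePreserving
open Summit.Ventures.GridStability.Models.NE39SP
open Summit.Ventures.GridStability.Lyapunov.StructurePreserving
open Summit.Ventures.GridStability.Lyapunov.StructurePreserving.Switch

namespace Summit.Ventures.GridStability.Bench.NE39SP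

/-! ### What the steps are -/

/-- At the stepped bus the injection of record DROPS by `s` (load pickup), provided it is not the supplier. [folklore] -/
theorem Pstep_at_self {i g : Fin 49} (h : i ≠ g) (s : ℚ) : Pstep i g s i = P0Q i - s := by
  simp [Pstep, h]

/-- At the supplying machine the injection of record RISES by `s`. [folklore] -/
theorem Pstep_at_supplier {i g : Fin 49} (h : i ≠ g) (s : ℚ) : Pstep i g s g = P0Q g + s := by
  simp [Pstep, h.symm]

/-- Every other injection is the injection of record. [folklore] -/
theorem Pstep_elsewhere {i g j : Fin 49} (hi : j ≠ i) (hg : j ≠ g) (s : ℚ) : Pstep i g s j = P0Q j := by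
  simp [Pstep, hi, hg]

/-- The full-loss step leaves the machine with injection EXACTLY `0`. [folklore] -/
theorem Pstep_fullLoss_self {k : Fin 49} (h : k ≠ 40) : Pstep k 40 (P0Q k) k = 0 := by
  simp [Pstep, h]

/-! ### Load pickup +5 pu at any network bus (39/39) -/

/-- The 39 network-bus nodes (buses 1–39 = nodes 0–38). [folklore] -/
def loadBusNodes : Finset (Fin 49) := {0, 1, 2, 3, 4, 5, 6, 7, 8, 9, 10, 11, 12, 13, 14, 15, 16, 17, 18, 19, 20, 21, 22, 23, 24, 25, 26, 27, 28, 29, 30, 31, 32, 33, 34, 35, 36, 37, 38}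

/-- The set is exactly the nodes below `39`, `39` of them. [folklore] -/
theorem loadBusNodes_spec : (∀ b : Fin 49, b ∈ loadBusNodes ↔ b.val < 39) ∧ loadBusNodes.card = 39 := by
  constructor
  · decide +kernel
  · decide +kernel

/-- **39/39**: every network bus carries a +5 pu load-pickup certificate (`R = 10⁻⁶`, `τγ = 21/100`, `c ≤ 141 / 100`) that
PASSES `Cert.checkP` (the 39 `stepcheckNN` theorems, collected). CERTIFIED column. [folklore] -/
theorem exists_stepcert : ∀ b ∈ loadBusNodes, ∃ C : Cert 49 56,
    C.R = 1 / 1000000 ∧ C.τγ = 21 / 100 ∧ C.c ≤ 141 / 100 ∧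
      C.checkP NE39SP.srcV NE39SP.tgtV NE39SP.wtLFQ (Pstep b 40 5) NE39SP.tLFQ 39 := by
  intro b hb
  fin_cases hb
  exacts [⟨stepcert01, rfl, rfl, by decide +kernel, stepcheck01⟩,
    ⟨stepcert02, rfl, rfl, by decide +kernel, stepcheck02⟩,
    ⟨stepcert03, rfl, rfl, by decide +kernel, stepcheck03⟩,
    ⟨stepcert04, rfl, rfl, by decide +kernel, stepcheck04⟩,
    ⟨stepcert05, rfl, rfl, by decide +kernel, stepcheck05⟩,
    ⟨stepcert06, rfl, rfl, by decide +kernel, stepcheck06⟩,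
    ⟨stepcert07, rfl, rfl, by decide +kernel, stepcheck07⟩,
    ⟨stepcert08, rfl, rfl, by decide +kernel, stepcheck08⟩,
    ⟨stepcert09, rfl, rfl, by decide +kernel, stepcheck09⟩,
    ⟨stepcert10, rfl, rfl, by decide +kernel, stepcheck10⟩,
    ⟨stepcert11, rfl, rfl, by decide +kernel, stepcheck11⟩,
    ⟨stepcert12, rfl, rfl, by decide +kernel, stepcheck12⟩,
    ⟨stepcert13, rfl, rfl, by decide +kernel, stepcheck13⟩,
    ⟨stepcert14, rfl, rfl, by decide +kernel, stepcheck14⟩,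
    ⟨stepcert15, rfl, rfl, by decide +kernel, stepcheck15⟩,
    ⟨stepcert16, rfl, rfl, by decide +kernel, stepcheck16⟩,
    ⟨stepcert17, rfl, rfl, by decide +kernel, stepcheck17⟩,
    ⟨stepcert18, rfl, rfl, by decide +kernel, stepcheck18⟩,
    ⟨stepcert19, rfl, rfl, by decide +kernel, stepcheck19⟩,
    ⟨stepcert20, rfl, rfl, by decide +kernel, stepcheck20⟩,
    ⟨stepcert21, rfl, rfl, by decide +kernel, stepcheck21⟩,
    ⟨stepcert22, rfl, rfl, by decide +kernel, stepcheck22⟩,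
    ⟨stepcert23, rfl, rfl, by decide +kernel, stepcheck23⟩,
    ⟨stepcert24, rfl, rfl, by decide +kernel, stepcheck24⟩,
    ⟨stepcert25, rfl, rfl, by decide +kernel, stepcheck25⟩,
    ⟨stepcert26, rfl, rfl, by decide +kernel, stepcheck26⟩,
    ⟨stepcert27, rfl, rfl, by decide +kernel, stepcheck27⟩,
    ⟨stepcert28, rfl, rfl, by decide +kernel, stepcheck28⟩,
    ⟨stepcert29, rfl, rfl, by decide +kernel, stepcheck29⟩,
    ⟨stepcert30, rfl, rfl, by decide +kernel, stepcheck30⟩,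
    ⟨stepcert31, rfl, rfl, by decide +kernel, stepcheck31⟩,
    ⟨stepcert32, rfl, rfl, by decide +kernel, stepcheck32⟩,
    ⟨stepcert33, rfl, rfl, by decide +kernel, stepcheck33⟩,
    ⟨stepcert34, rfl, rfl, by decide +kernel, stepcheck34⟩,
    ⟨stepcert35, rfl, rfl, by decide +kernel, stepcheck35⟩,
    ⟨stepcert36, rfl, rfl, by decide +kernel, stepcheck36⟩,
    ⟨stepcert37, rfl, rfl, by decide +kernel, stepcheck37⟩,
    ⟨stepcert38, rfl, rfl, by decide +kernel, stepcheck38⟩,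
    ⟨stepcert39, rfl, rfl, by decide +kernel, stepcheck39⟩]

/-- **THE UNIFORM LOAD-PICKUP SENTENCE (39/39), MODEL MV-3, New England SP column LF.** For EVERY network bus node
`b` and EVERY `D > 0`: certificate data `C` (`R = 10⁻⁶`, `τγ = 21/100`, `c ≤ 141 / 100`, check passed) and a synchronous
angle vector `θ` of the post-step model `paramsStep b 40 5 D` (+5 pu load at `b` supplied by G2 at `t = 0`; network,
inertias, `D` unchanged) exist — all 49 power-flow equations exactly, `θ` within `10⁻⁶` rad of `halfAngle C.t1`,
coupled branches inside `2·arctan(21/100)` — and EVERY solution from the PRE-step synchronous state keeps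
Vu–Turitsyn's polytope and `V(θ; ·) ≤ c` for all `t ≥ 0`, converges to `θ + κ·1` and has machine speeds `→ 0`.
No sentence here says the New England system is stable. [cite: VuTuritsyn2016, §IV, §VI; Padiyar2013, App. D] -/
theorem loadstep5_resync (b : Fin 49) (hb : b ∈ loadBusNodes) (D : Fin 49 → ℝ) (hD : ∀ j, 0 < D j) :
    ∃ C : Cert 49 56, C.R = 1 / 1000000 ∧ C.τγ = 21 / 100 ∧ C.c ≤ 141 / 100 ∧
      C.checkP NE39SP.srcV NE39SP.tgtV NE39SP.wtLFQ (Pstep b 40 5) NE39SP.tLFQ 39 ∧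
      ∃ θ : Fin 49 → ℝ,
        θ 39 = halfAngle (fun j => (C.t1 j : ℝ)) 39 ∧
        (∀ j, |θ j - halfAngle (fun j => (C.t1 j : ℝ)) j| < (C.R : ℝ)) ∧
        (∀ j, (paramsStep b 40 5 D).pe θ j = (paramsStep b 40 5 D).P0 j) ∧
        (∀ a b, a ≠ b → (paramsStep b 40 5 D).b a b ≠ 0 →
          |θ a - θ b| < 2 * Real.arctan (C.τγ : ℝ)) ∧
        ∀ δ : ℝ → Fin 49 → ℝ, (paramsStep b 40 5 D).IsSolution δ → δ 0 = NE39SP.δ₀ →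
          (∀ j ∈ NE39SP.genS, deriv (fun u => δ u j) 0 = 0) →
          (∀ t, 0 ≤ t →
              (∀ a b, (paramsStep b 40 5 D).b a b ≠ 0 → |(δ t a - δ t b) + (θ a - θ b)| < π) ∧
                (paramsStep b 40 5 D).energy θ (δ t) (fun j => deriv (fun u => δ u j) t)
                  ≤ (C.c : ℝ)) ∧
            Tendsto δ atTop (𝓝 fun j => θ j + (∑ k, D k * (NE39SP.δ₀ k - θ k)) / ∑ k, D k) ∧
            ∀ j ∈ NE39SP.genS, Tendsto (fun t => deriv (fun u => δ u j) t) atTop (𝓝 0) := by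
  obtain ⟨C, hR, hτ, hc, hchk⟩ := exists_stepcert b hb
  exact ⟨C, hR, hτ, hc, hchk, step_resync_NE39SP hchk D hD⟩

/-! ### Full loss of any machine's mechanical input (9/9) -/

/-- The nine machines other than the external equivalent G2 (internal nodes). [folklore] -/
def lossMachines : Finset (Fin 49) := {39, 41, 42, 43, 44, 45, 46, 47, 48}

/-- The set is exactly `genS` without node `40`. [folklore] -/
theorem lossMachines_spec : ∀ k : Fin 49, k ∈ lossMachines ↔ (k ∈ NE39SP.genS ∧ k ≠ 40) := by
  decide +kernel

/-- **9/9**: every machine other than G2 carries a full-loss certificate (`R = 10⁻⁶`, `τγ = 21/100`, `c ≤ 141 / 25`)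
that PASSES `Cert.checkP` against `Pstep k 40 (P0Q k)`. CERTIFIED column. [folklore] -/
theorem exists_genlosscert : ∀ k ∈ lossMachines, ∃ C : Cert 49 56,
    C.R = 1 / 1000000 ∧ C.τγ = 21 / 100 ∧ C.c ≤ 141 / 25 ∧
      C.checkP NE39SP.srcV NE39SP.tgtV NE39SP.wtLFQ (Pstep k 40 (P0Q k)) NE39SP.tLFQ 39 := by
  intro k hk
  fin_cases hk
  exacts [⟨genlosscert39, rfl, rfl, by decide +kernel, genlosscheck39⟩,
    ⟨genlosscert41, rfl, rfl, by decide +kernel, genlosscheck41⟩,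
    ⟨genlosscert42, rfl, rfl, by decide +kernel, genlosscheck42⟩,
    ⟨genlosscert43, rfl, rfl, by decide +kernel, genlosscheck43⟩,
    ⟨genlosscert44, rfl, rfl, by decide +kernel, genlosscheck44⟩,
    ⟨genlosscert45, rfl, rfl, by decide +kernel, genlosscheck45⟩,
    ⟨genlosscert46, rfl, rfl, by decide +kernel, genlosscheck46⟩,
    ⟨genlosscert47, rfl, rfl, by decide +kernel, genlosscheck47⟩,
    ⟨genlosscert48, rfl, rfl, by decide +kernel, genlosscheck48⟩]

/-- **THE UNIFORM GENERATION-LOSS SENTENCE (9/9), MODEL MV-3, New England SP column LF.** For EVERY machine `k`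
other than G2 and EVERY `D > 0`: certificate data `C` (`c ≤ 141 / 25`, check passed) and a synchronous angle vector
`θ` of the post-step model `paramsStep k 40 (P0Q k) D` (machine `k`'s injection exactly `0`, G2's raised by `P0Q k`,
at `t = 0`) exist, and EVERY solution from the PRE-step synchronous state keeps the polytope and `V(θ; ·) ≤ c`,
converges to `θ + κ·1`, machine speeds `→ 0`. No sentence here says the New England system is stable.
[cite: VuTuritsyn2016, §IV, §VI; Padiyar2013, App. D] -/
theorem genloss_resync (k : Fin 49) (hk : k ∈ lossMachines) (D : Fin 49 → ℝ) (hD : ∀ j, 0 < D j) :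
    ∃ C : Cert 49 56, C.R = 1 / 1000000 ∧ C.τγ = 21 / 100 ∧ C.c ≤ 141 / 25 ∧
      C.checkP NE39SP.srcV NE39SP.tgtV NE39SP.wtLFQ (Pstep k 40 (P0Q k)) NE39SP.tLFQ 39 ∧
      ∃ θ : Fin 49 → ℝ,
        θ 39 = halfAngle (fun j => (C.t1 j : ℝ)) 39 ∧
        (∀ j, |θ j - halfAngle (fun j => (C.t1 j : ℝ)) j| < (C.R : ℝ)) ∧
        (∀ j, (paramsStep k 40 (P0Q k) D).pe θ j = (paramsStep k 40 (P0Q k) D).P0 j) ∧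
        (∀ a b, a ≠ b → (paramsStep k 40 (P0Q k) D).b a b ≠ 0 →
          |θ a - θ b| < 2 * Real.arctan (C.τγ : ℝ)) ∧
        ∀ δ : ℝ → Fin 49 → ℝ, (paramsStep k 40 (P0Q k) D).IsSolution δ → δ 0 = NE39SP.δ₀ →
          (∀ j ∈ NE39SP.genS, deriv (fun u => δ u j) 0 = 0) →
          (∀ t, 0 ≤ t →
              (∀ a b, (paramsStep k 40 (P0Q k) D).b a b ≠ 0 → |(δ t a - δ t b) + (θ a - θ b)| < π) ∧
                (paramsStep k 40 (P0Q k) D).energy θ (δ t) (fun j => deriv (fun u => δ u j) t)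
                  ≤ (C.c : ℝ)) ∧
            Tendsto δ atTop (𝓝 fun j => θ j + (∑ k, D k * (NE39SP.δ₀ k - θ k)) / ∑ k, D k) ∧
            ∀ j ∈ NE39SP.genS, Tendsto (fun t => deriv (fun u => δ u j) t) atTop (𝓝 0) := by
  obtain ⟨C, hR, hτ, hc, hchk⟩ := exists_genlosscert k hk
  exact ⟨C, hR, hτ, hc, hchk, step_resync_NE39SP hchk D hD⟩

/-! ### Transient machine-speed bound for every certified step -/

/-- **Machine-speed bound along a certified injection step** (generic over the step data): under the hypothesis
`C.checkP … (Pstep i g s) …`, along every solution of `paramsStep i g s D` from the pre-step synchronous state,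
`|δ̇ⱼ(t)| ≤ √(2·c/Mⱼ)` at every machine for all `t ≥ 0` (kinetic `≤ V ≤ c`, potential `≥ 0` on the polytope).
[cite: VuTuritsyn2016, §IV; Padiyar2013, §3.2 eq (3.11)] -/
theorem step_machine_speed_bound {i g : Fin 49} {s : ℚ} {C : Cert 49 56}
    (hchk : C.checkP NE39SP.srcV NE39SP.tgtV NE39SP.wtLFQ (Pstep i g s) NE39SP.tLFQ 39)
    (D : Fin 49 → ℝ) (hD : ∀ j, 0 < D j) :
    ∃ θ : Fin 49 → ℝ, (∀ j, (paramsStep i g s D).pe θ j = (paramsStep i g s D).P0 j) ∧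
      ∀ δ : ℝ → Fin 49 → ℝ, (paramsStep i g s D).IsSolution δ → δ 0 = NE39SP.δ₀ →
        (∀ j ∈ NE39SP.genS, deriv (fun u => δ u j) 0 = 0) →
        ∀ t, 0 ≤ t → ∀ j ∈ NE39SP.genS,
          |deriv (fun u => δ u j) t| ≤ Real.sqrt (2 * (C.c : ℝ) / (NE39SP.MQ j : ℝ)) := by
  obtain ⟨θ, -, -, heq, hcoh, hdyn⟩ := step_resync_NE39SP hchk D hD
  refine ⟨θ, heq, fun δ hδ hδ0 hv0 t ht j hj => ?_⟩
  obtain ⟨hstay, -, -⟩ := hdyn δ hδ hδ0 hv0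
  obtain ⟨hpol, hV⟩ := hstay t ht
  have hτ1 : (C.τγ : ℝ) < 1 := by exact_mod_cast hchk.1.2.2.2.2.1
  have hbnn : ∀ a b, 0 ≤ (paramsStep i g s D).b a b := fun a b => by
    rw [paramsStep_b]
    exact symmetrize_nonneg (edgeWeight_nonneg fun e => by exact_mod_cast (hchk.2.1 e).1) a b
  have h0 : ∀ a b, (paramsStep i g s D).b a b ≠ 0 → |θ a - θ b| ≤ π / 2 := by
    intro a b hab
    by_cases h : a = b
    · subst h
      rw [sub_self, abs_zero]
      positivity
    · exact ((hcoh a b h hab).trans (two_mul_arctan_lt_pi_div_two hτ1)).le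
  have := speed_le_of_energy_le (paramsStep_wellFormed i g s hD) hbnn h0
    (fun a b hab => (hpol a b hab).le) hV j hj
  have hM : (paramsStep i g s D).M j = (NE39SP.MQ j : ℝ) := rfl
  rw [hM] at this
  exact this

end Summit.Ventures.GridStability.Bench.NE39SP

end
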